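import Literature.MathematicalPhysics.QuantumManyBody.PeriodicKyFanGapFeynmanKac
import HarnessLib

/-!
# Crux `PeriodicIRBound` (stmt-AtomisticToContinuum-3972), line `linear-ph-floor-wagner`, stub S-B
# `stub_fkPositiveOfMinimiser` — part 2: Jensen's lower bound `⟨φ, e^{-τH}φ⟩ ≥ ‖φ‖² e^{-τ𝓔(φ)/‖φ‖²}`
# from the small-time form upper bound (stub S-A) by dyadic log-convexity

Helper file of the line lead (seat c2), sequel of `…PFOpNorm.lean`. For the torus Feynman–Kac semigroup
`T_t = pfkL2 v L t` on `L²([0,L)^{3N})` (self-adjoint, `T_{2s} = T_s²`) and a unit vector `y`, the pairings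
`⟪T_{τ/2^m} y, y⟫` are log-convex along the dyadic chain (`inner_le_rpow_of_comp_sq`), so
`⟪T_τ y, y⟫ ≥ ⟪T_{τ/2^m} y, y⟫^{2^m}` (`inner_pfkL2_ge_pow`). If the small-time FORM UPPER BOUND of stub S-A
holds (`‖φ‖² - ⟨φ, T_sφ⟩ ≤ s(𝓔(φ) + ε)` for `s < s₀(ε)`, `𝓔(φ) = ∫_cell|∇φ|² + ∫_cell Vφ²`), then letting
`m → ∞` in `(1 - (τ/2^m)(𝓔+ε)/‖φ‖²)^{2^m}` gives Jensen's inequality for the spectral measure without any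
spectral theorem: **`⟨φ, T_τ φ⟩_cell ≥ ‖φ‖²_cell · exp(-τ𝓔(φ)/‖φ‖²_cell)`** for every real periodic `C¹`
function `φ` with finite potential energy (`setIntegral_mul_pfkReal_ge_exp_of_formUpperBound`). The form
upper bound enters as an explicit hypothesis (the registered stub S-A, verbatim).

References: Reed–Simon IV §XIII.12; Chung–Zhao (1995) Prop 3.29; Glimm–Jaffe §3.4.
-/

noncomputable section

open scoped BigOperators ENNReal NNReal InnerProductSpace Topology
open Filter MeasureTheory

namespace Summit.AtomisticToContinuum.BoseEinsteinCondensation.Cruxes.PeriodicIRBound.LinearPhFloorWagner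

open Literature.MathematicalPhysics.QuantumManyBody
open Literature.MathematicalPhysics.QuantumManyBody.BoseGas

variable {N : ℕ}

/-! ## §1 Dyadic log-convexity for the torus semigroup -/

/-- **`⟪T_τ y, y⟫ ≥ ⟪T_{τ/2^m} y, y⟫^{2^m}` for a unit vector** (`T_t = e^{-tH}` on `L²(cell)`; Jensen along the
dyadic chain `T_{2s} = T_s ∘ T_s`, `inner_le_rpow_of_comp_sq`). [folklore] -/
theorem inner_pfkL2_ge_pow {v : ℝ → ℝ≥0∞} (hv : Measurable v) {L : ℝ} (hL : 0 < L) {τ : ℝ} (hτ : 0 < τ)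
    (y : Lp ℝ 2 (volume.restrict (cellN N L))) (hy : ‖y‖ = 1) (m : ℕ) :
    ⟪pfkL2 v L (τ / 2 ^ m) y, y⟫_ℝ ^ (2 ^ m) ≤ ⟪pfkL2 v L τ y, y⟫_ℝ := by
  set S : ℕ → (Lp ℝ 2 (volume.restrict (cellN N L)) →L[ℝ] Lp ℝ 2 (volume.restrict (cellN N L))) :=
    fun k => pfkL2 v L (τ / 2 ^ k) with hS
  have hpos : ∀ k : ℕ, 0 < τ / 2 ^ k := fun k => by positivity
  have hsym : ∀ k (x z : Lp ℝ 2 (volume.restrict (cellN N L))), ⟪S k x, z⟫_ℝ = ⟪x, S k z⟫_ℝ :=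
    fun k x z => inner_pfkL2_comm hv hL (hpos k) x z
  have hsq : ∀ k, S k = (S (k + 1)).comp (S (k + 1)) := fun k => by
    have h := pfkL2_eq_comp_half (N := N) hv hL (hpos k)
    have hk : τ / 2 ^ k / 2 = τ / 2 ^ (k + 1) := by rw [pow_succ]; ring
    simp only [hS]
    rw [h, hk]
  have h := inner_le_rpow_of_comp_sq S hsym hsq hy m
  have ha : 0 ≤ ⟪S m y, y⟫_ℝ := inner_pfkL2_self_nonneg hv hL (hpos m) y
  have hc : 0 ≤ ⟪S 0 y, y⟫_ℝ := inner_pfkL2_self_nonneg hv hL (hpos 0) y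
  have hS0 : S 0 = pfkL2 v L τ := by simp [hS]
  have hSm : S m = pfkL2 v L (τ / 2 ^ m) := rfl
  rw [← hSm, ← hS0]
  calc ⟪S m y, y⟫_ℝ ^ (2 ^ m) ≤ (⟪S 0 y, y⟫_ℝ ^ ((1 / 2 : ℝ) ^ m)) ^ (2 ^ m) := pow_le_pow_left₀ ha h _
    _ = ⟪S 0 y, y⟫_ℝ := by
        rw [← Real.rpow_natCast, ← Real.rpow_mul hc]
        have h1 : (1 / 2 : ℝ) ^ m * ((2 ^ m : ℕ) : ℝ) = 1 := by
          rw [Nat.cast_pow, Nat.cast_ofNat, ← mul_pow]; norm_num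
        rw [h1, Real.rpow_one]

/-- The elementary limit `(1 - a/2^m)^{2^m} → e^{-a}`. [folklore] -/
theorem tendsto_one_sub_div_two_pow_pow (a : ℝ) :
    Tendsto (fun m : ℕ => (1 - a / 2 ^ m) ^ (2 ^ m)) atTop (𝓝 (Real.exp (-a))) := by
  have h := (Real.tendsto_one_add_div_pow_exp (-a)).comp (tendsto_pow_atTop_atTop_of_one_lt (one_lt_two : (1 : ℕ) < 2))
  refine h.congr fun m => ?_
  simp only [Function.comp_apply, Nat.cast_pow, Nat.cast_ofNat]
  ring

/-! ## §2 Jensen's lower bound from the form upper bound -/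

/-- **Jensen's inequality for the torus Feynman–Kac pairing from the small-time form upper bound.** If the form
upper bound of stub S-A holds (hypothesis `hFUB`, verbatim the registered statement), then for `L > 0`, a measurable
profile `v` with `∫_cell V < ∞`, a real periodic `C¹` function `φ` with `∫_cell Vφ² < ∞`, and `τ > 0`,
`‖φ‖²_cell · exp(-τ(∫_cell|∇φ|² + ∫_cell Vφ²)/‖φ‖²_cell) ≤ ⟨φ, e^{-τH}φ⟩_cell`. [cite: ReedSimonIV1978, Thm XIII.44] -/
theorem setIntegral_mul_pfkReal_ge_exp_of_formUpperBound
    (hFUB : ∀ {N : ℕ} {L : ℝ}, 0 < L → ∀ {v : ℝ → ℝ≥0∞}, Measurable v →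
      (∫⁻ X in cellN N L, periodicInteraction v L X) ≠ ⊤ →
      ∀ {ψ : Config N → ℝ}, ContDiff ℝ 1 ψ →
        (∀ (X : Config N) (i : Fin N) (k : Fin 3), ψ (X + Pi.single i (EuclideanSpace.single k L)) = ψ X) →
        (∫⁻ X in cellN N L, ENNReal.ofReal (ψ X ^ 2) * periodicInteraction v L X) ≠ ⊤ →
        ∀ ε : ℝ, 0 < ε → ∃ t₀ : ℝ, 0 < t₀ ∧ ∀ t : ℝ≥0, t ≠ 0 → (t : ℝ) < t₀ →
          (∫ X in cellN N L, ψ X ^ 2) - ∫ X in cellN N L, ψ X * pfkReal v L t ψ X ≤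
            t * ((∫⁻ X in cellN N L, realKinetic ψ X).toReal +
              (∫⁻ X in cellN N L, ENNReal.ofReal (ψ X ^ 2) * periodicInteraction v L X).toReal + ε))
    {L : ℝ} (hL : 0 < L) {v : ℝ → ℝ≥0∞} (hv : Measurable v)
    (hW : ∫⁻ X in cellN N L, periodicInteraction v L X ≠ ⊤) {φ : Config N → ℝ} (hφ : ContDiff ℝ 1 φ)
    (hper : ∀ (X : Config N) (i : Fin N) (k : Fin 3), φ (X + Pi.single i (EuclideanSpace.single k L)) = φ X)
    (hpot : ∫⁻ X in cellN N L, ENNReal.ofReal (φ X ^ 2) * periodicInteraction v L X ≠ ⊤) {τ : ℝ} (hτ : 0 < τ) :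
    (∫ X in cellN N L, φ X ^ 2) *
        Real.exp (-(τ * ((∫⁻ X in cellN N L, realKinetic φ X).toReal +
          (∫⁻ X in cellN N L, ENNReal.ofReal (φ X ^ 2) * periodicInteraction v L X).toReal) /
            ∫ X in cellN N L, φ X ^ 2)) ≤
      ∫ X in cellN N L, φ X * pfkReal v L τ φ X := by
  -- notation
  set E : ℝ := (∫⁻ X in cellN N L, realKinetic φ X).toReal +
    (∫⁻ X in cellN N L, ENNReal.ofReal (φ X ^ 2) * periodicInteraction v L X).toReal with hEdef
  have hE0 : 0 ≤ E := by positivity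
  have hmem : MemLp φ 2 (volume.restrict (cellN N L)) := memLp_two_cellN_of_contDiff_periodic hL hφ hper
  set x : Lp ℝ 2 (volume.restrict (cellN N L)) := hmem.toLp φ with hxdef
  set n2 : ℝ := ∫ X in cellN N L, φ X ^ 2 with hn2def
  have hn2 : ‖x‖ ^ 2 = n2 := norm_toLp_sq_real hmem
  have hinner : ∀ {t : ℝ}, 0 < t → ⟪pfkL2 v L t x, x⟫_ℝ = ∫ X in cellN N L, φ X * pfkReal v L t φ X :=
    fun ht => inner_pfkL2_toLp_toLp hv hL ht hmem hmem hper
  rw [← hinner hτ]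
  have hn2nn : 0 ≤ n2 := by rw [← hn2]; positivity
  rcases hn2nn.eq_or_lt with h0 | hn2pos
  · -- `‖φ‖ = 0`
    rw [← h0, zero_mul]
    exact inner_pfkL2_self_nonneg hv hL hτ x
  -- normalise
  have hxpos : 0 < ‖x‖ := by
    have h : ‖x‖ ≠ 0 := fun h => by
      rw [h] at hn2
      norm_num at hn2
      linarith
    exact lt_of_le_of_ne (norm_nonneg _) (Ne.symm h)
  set y : Lp ℝ 2 (volume.restrict (cellN N L)) := ‖x‖⁻¹ • x with hydef
  have hy : ‖y‖ = 1 := by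
    rw [hydef, norm_smul, norm_inv, norm_norm, inv_mul_cancel₀ hxpos.ne']
  have hyinner : ∀ t : ℝ, ⟪pfkL2 v L t y, y⟫_ℝ = ‖x‖⁻¹ ^ 2 * ⟪pfkL2 v L t x, x⟫_ℝ := fun t => by
    rw [hydef, map_smul, inner_smul_left, inner_smul_right]
    simp only [conj_trivial]
    ring
  have hinv : ‖x‖⁻¹ ^ 2 = n2⁻¹ := by rw [inv_pow, hn2]
  -- it suffices to bound the normalised pairing
  suffices hsuff : Real.exp (-(τ * E / n2)) ≤ ⟪pfkL2 v L τ y, y⟫_ℝ by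
    rw [hyinner, hinv] at hsuff
    have h1 := mul_le_mul_of_nonneg_left hsuff hn2nn
    calc n2 * Real.exp (-(τ * E / n2)) ≤ n2 * (n2⁻¹ * ⟪pfkL2 v L τ x, x⟫_ℝ) := h1
      _ = ⟪pfkL2 v L τ x, x⟫_ℝ := by rw [← mul_assoc, mul_inv_cancel₀ hn2pos.ne', one_mul]
  -- for every `ε > 0`
  have hε : ∀ ε : ℝ, 0 < ε → Real.exp (-(τ * (E + ε) / n2)) ≤ ⟪pfkL2 v L τ y, y⟫_ℝ := by
    intro ε hε
    obtain ⟨t₀, ht₀, hbound⟩ := hFUB hL hv hW hφ hper hpot ε hε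
    set a : ℝ := τ * (E + ε) / n2 with hadef
    have h2 : Tendsto (fun m : ℕ => (2 : ℝ) ^ m) atTop atTop := tendsto_pow_atTop_atTop_of_one_lt one_lt_two
    have hev1 : ∀ᶠ m : ℕ in atTop, τ / 2 ^ m < t₀ :=
      (tendsto_const_nhds.div_atTop h2).eventually (eventually_lt_nhds ht₀)
    have hev2 : ∀ᶠ m : ℕ in atTop, a / 2 ^ m ≤ 1 :=
      (tendsto_const_nhds.div_atTop h2).eventually (eventually_le_nhds one_pos)
    have hevb : ∀ᶠ m : ℕ in atTop, (1 - a / 2 ^ m) ^ (2 ^ m) ≤ ⟪pfkL2 v L τ y, y⟫_ℝ := by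
      filter_upwards [hev1, hev2] with m hm1 hm2
      have hsm : 0 < τ / 2 ^ m := by positivity
      have hb := hbound (τ / 2 ^ m).toNNReal (by rw [Ne, Real.toNNReal_eq_zero, not_le]; exact hsm)
        (by rw [Real.coe_toNNReal _ hsm.le]; exact hm1)
      rw [Real.coe_toNNReal _ hsm.le, ← hEdef, ← hn2def, ← hinner hsm] at hb
      have hb' : n2 - τ / 2 ^ m * (E + ε) ≤ ⟪pfkL2 v L (τ / 2 ^ m) x, x⟫_ℝ := by linarith
      have hby : 1 - a / 2 ^ m ≤ ⟪pfkL2 v L (τ / 2 ^ m) y, y⟫_ℝ := by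
        rw [hyinner, hinv]
        have : 1 - a / 2 ^ m = n2⁻¹ * (n2 - τ / 2 ^ m * (E + ε)) := by
          rw [hadef]
          field_simp
        rw [this]
        exact mul_le_mul_of_nonneg_left hb' (inv_nonneg.2 hn2nn)
      have hb0 : 0 ≤ 1 - a / 2 ^ m := by linarith
      calc (1 - a / 2 ^ m) ^ (2 ^ m) ≤ ⟪pfkL2 v L (τ / 2 ^ m) y, y⟫_ℝ ^ (2 ^ m) := pow_le_pow_left₀ hb0 hby _
        _ ≤ ⟪pfkL2 v L τ y, y⟫_ℝ := inner_pfkL2_ge_pow hv hL hτ y hy m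
    exact le_of_tendsto (tendsto_one_sub_div_two_pow_pow a) hevb
  -- `ε → 0`
  have hlim : Tendsto (fun k : ℕ => Real.exp (-(τ * (E + 1 / ((k : ℝ) + 1)) / n2))) atTop
      (𝓝 (Real.exp (-(τ * E / n2)))) := by
    have hk : Tendsto (fun k : ℕ => (1 : ℝ) / ((k : ℝ) + 1)) atTop (𝓝 0) := tendsto_one_div_add_atTop_nhds_zero_nat
    have h1 : Tendsto (fun k : ℕ => -(τ * (E + 1 / ((k : ℝ) + 1)) / n2)) atTop (𝓝 (-(τ * (E + 0) / n2))) :=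
      (((tendsto_const_nhds.add hk).const_mul τ).div_const n2).neg
    rw [add_zero] at h1
    exact (Real.continuous_exp.tendsto _).comp h1
  exact le_of_tendsto' hlim fun k => hε _ (by positivity)

/-- **Registered sub-goal `stub_pfJensen` of the crux item** (S-B part 2, line `linear-ph-floor-wagner`, v11): Jensen's
lower bound for the torus Feynman–Kac pairing from the form upper bound of stub S-A
(`setIntegral_mul_pfkReal_ge_exp_of_formUpperBound`). [cite: ReedSimonIV1978, Thm XIII.44] -/
theorem stub_pfJensen :
    (∀ {N : ℕ} {L : ℝ}, 0 < L → ∀ {v : ℝ → ℝ≥0∞}, Measurable v → (∫⁻ X in cellN N L, periodicInteraction v L X) ≠ ⊤ → ∀ {ψ : Config N → ℝ}, ContDiff ℝ 1 ψ → (∀ (X : Config N) (i : Fin N) (k : Fin 3), ψ (X + Pi.single i (EuclideanSpace.single k L)) = ψ X) → (∫⁻ X in cellN N L, ENNReal.ofReal (ψ X ^ 2) * periodicInteraction v L X) ≠ ⊤ → ∀ ε : ℝ, 0 < ε → ∃ t₀ : ℝ, 0 < t₀ ∧ ∀ t : ℝ≥0, t ≠ 0 → (t : ℝ) < t₀ →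 (∫ X in cellN N L, ψ X ^ 2) - ∫ X in cellN N L, ψ X * pfkReal v L t ψ X ≤ t * ((∫⁻ X in cellN N L, realKinetic ψ X).toReal + (∫⁻ X in cellN N L, ENNReal.ofReal (ψ X ^ 2) * periodicInteraction v L X).toReal + ε)) → ∀ {N : ℕ} {L : ℝ}, 0 < L → ∀ {v : ℝ → ℝ≥0∞}, Measurable v → (∫⁻ X in cellN N L, periodicInteraction v L X) ≠ ⊤ → ∀ {φ : Config N → ℝ}, ContDiff ℝ 1 φ → (∀ (X : Config N) (i : Fin N) (k : Fin 3), φ (X + Pi.single i (EuclideanSpace.single k L)) = φ X) → (∫⁻ X in cellN N L, ENNReal.ofReal (φ X ^ 2) * periodicInteraction v L X) ≠ ⊤ → ∀ {τ : ℝ}, 0 < τ → (∫ X in cellN N L, φ X ^ 2) * Real.exp (-(τ * ((∫⁻ X in cellN N L, realKinetic φ X).toReal + (∫⁻ X in cellN N L, ENNReal.ofReal (φ X ^ 2) * periodicInteraction v L X).toReal) / ∫ X in cellN N L, φ X ^ 2)) ≤ ∫ X in cellN N L, φ X * pfkReal v L τ φ X :=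
  fun hFUB _ _ hL _ hv hW _ hφ hper hpot _ hτ =>
    setIntegral_mul_pfkReal_ge_exp_of_formUpperBound hFUB hL hv hW hφ hper hpot hτ

end Summit.AtomisticToContinuum.BoseEinsteinCondensation.Cruxes.PeriodicIRBound.LinearPhFloorWagner

end
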